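import Mathlib.Analysis.InnerProductSpace.Calculus
import Literature.Analysis.FluidPDE.VorticityStretching
import Literature.Analysis.FluidPDE.LerayProfileCalculus
import Literature.Analysis.FluidPDE.SpaceTimeCalculus
import Literature.Analysis.FluidPDE.ClassicalSolutionCalculus
import HarnessLib

/-!
# Crux `FrequencyRigidity` (stmt-NavierStokesRegularity-2955), line `two-ended-pinning`:
  STUB `stub_vorticitySqTransport` — the transport identity for `‖ω‖²`

Helper file (lands `--supports stmt-NavierStokesRegularity-2955`) proving the registered stub
`stub_vorticitySqTransport` of the line's skeleton: for a classical Navier–Stokes flow `(v, q)`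
(viscosity `ν`, zero force) on `ℝ³ × (−∞, 0)` and `ω = curl v`, pointwise at every `t < 0` and
every `x`,

  `∂ₜ‖ω‖² + D(‖ω‖²)·v − ν Δ‖ω‖² = 2 (⟪ω, Dv ω⟫ − ν |Dω|²_F)`.

Proof: `∂ₜ‖ω‖² = 2⟪ω, ∂ₜω⟫` with `∂ₜω = curl ∂ₜv` (exchange of `∂ₜ` and `D` on the open time
set `Iio 0`, `IsSmoothSpaceTimeOn.hasDerivAt_fderiv_slice_timeDerivWithin`, composed with the
fixed linear map `curlCLM`), the tree's vorticity equation in stretching form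
`IsClassicalNSSolutionOn.curl_timeDerivWithin_eq` (`curl ∂ₜv = νΔω − (v·∇)ω + (ω·∇)v`),
`D‖ω‖²·v = 2⟪ω, Dω v⟫` (Mathlib `HasFDerivAt.norm_sq`), and
`Δ‖ω‖² = 2⟪Δω, ω⟫ + 2|Dω|²_F` (`laplacian_inner_self_eq`); the transport terms cancel.

Sources: A. J. Majda, A. L. Bertozzi, *Vorticity and Incompressible Flow* (CUP 2002), §1.1,
(1.33) [`MajdaBertozziCUP2002`]; T. Tao, arXiv:1108.1165, §10, (10.18) [`Tao2011`].
-/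

noncomputable section

namespace Summit.NavierStokesRegularity.NavierStokesRegularity.Theorems.FrequencyRigidity.TwoEndedPinning

open Literature.Analysis.FluidPDE MeasureTheory Set Filter Topology Function
open scoped RealInnerProductSpace Laplacian ContDiff

/-- **`∂ₜ ω = curl ∂ₜ v` on the open time set `(−∞, 0)`**: for a field `v` jointly smooth on
`Iio 0 × ℝ³`, the time line `s ↦ curl (v s) x` has derivative `curl (timeDerivWithin (Iio 0) v t) x`
at every `t < 0` (exchange of `∂ₜ` and `D`, composed with the linear map `curlCLM`). [folklore] -/
theorem hasDerivAt_curl_timeLine {v : ℝ → EuclideanSpace ℝ (Fin 3) → EuclideanSpace ℝ (Fin 3)}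
    (h : IsSmoothSpaceTimeOn (Iio 0) v) {t : ℝ} (ht : t < 0) (x : EuclideanSpace ℝ (Fin 3)) :
    HasDerivAt (fun s => curl (v s) x) (curl (timeDerivWithin (Iio 0) v t) x) t := by
  have hD : HasDerivAt (fun s => fderiv ℝ (v s) x) (fderiv ℝ (timeDerivWithin (Iio 0) v t) x) t :=
    h.hasDerivAt_fderiv_slice_timeDerivWithin isOpen_Iio subset_rfl ht x
  exact curlCLM.hasFDerivAt.comp_hasDerivAt t hD

/-- **Transport identity for `‖ω‖²`** (registered stub `stub_vorticitySqTransport` of the line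
`two-ended-pinning`): for a classical Navier–Stokes flow `(v, q)` with viscosity `ν` and zero force
on `ℝ³ × (−∞, 0)` and `ω = curl v`, at every `t < 0` and every `x`,
`∂ₜ‖ω‖² + D(‖ω‖²)·v − νΔ‖ω‖² = 2(⟪ω, Dv ω⟫ − ν|Dω|²_F)` — `2⟪ω, ·⟫` of the vorticity equation
`∂ₜω + (v·∇)ω − νΔω = (ω·∇)v` plus `Δ‖ω‖² = 2⟪Δω, ω⟫ + 2|Dω|²_F`.
[cite: MajdaBertozziCUP2002, §1.1 (1.33)] -/
theorem stub_vorticitySqTransport :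
  ∀ (ν : ℝ) (v : ℝ → EuclideanSpace ℝ (Fin 3) → EuclideanSpace ℝ (Fin 3))
    (q : ℝ → EuclideanSpace ℝ (Fin 3) → ℝ),
    Literature.Analysis.FluidPDE.IsClassicalNSSolutionOn (Set.Iio 0) ν 0 v q →
    ∀ t : ℝ, t < 0 → ∀ x : EuclideanSpace ℝ (Fin 3),
      deriv (fun s => ‖Literature.Analysis.FluidPDE.curl (v s) x‖ ^ 2) t
          + fderiv ℝ (fun y => ‖Literature.Analysis.FluidPDE.curl (v t) y‖ ^ 2) x (v t x)
          - ν * Laplacian.laplacian (fun y => ‖Literature.Analysis.FluidPDE.curl (v t) y‖ ^ 2) x =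
        2 * (inner ℝ (Literature.Analysis.FluidPDE.curl (v t) x)
                (fderiv ℝ (v t) x (Literature.Analysis.FluidPDE.curl (v t) x))
              - ν * Literature.Analysis.FluidPDE.frobeniusNormSq
                (fderiv ℝ (Literature.Analysis.FluidPDE.curl (v t)) x)) := by
  intro ν v q hns t ht x
  have htS : t ∈ Iio (0 : ℝ) := ht
  -- regularity of the slice and of its curl
  have hv : ContDiff ℝ ∞ (v t) := hns.contDiff_velocity htS
  have hω : ContDiff ℝ ∞ (curl (v t)) := by
    rw [curl_eq_curlCLM_comp]
    exact curlCLM.contDiff.comp (hv.fderiv_right (m := ∞) (by simp))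
  have hω2 : ContDiff ℝ 2 (curl (v t)) := hω.of_le (by norm_cast)
  have hωd : DifferentiableAt ℝ (curl (v t)) x := (hω.differentiable (by simp)) x
  -- (i) the time derivative: `∂ₜ‖ω‖² = 2⟪ω, curl ∂ₜv⟫`
  have h1 : deriv (fun s => ‖curl (v s) x‖ ^ 2) t =
      2 * ⟪curl (v t) x, curl (timeDerivWithin (Iio 0) v t) x⟫ :=
    (hasDerivAt_curl_timeLine hns.smooth_velocity ht x).norm_sq.deriv
  -- (ii) the vorticity equation in stretching form
  have h2 : curl (timeDerivWithin (Iio 0) v t) x =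
      ν • (Δ (curl (v t))) x - convect (v t) (curl (v t)) x + convect (curl (v t)) (v t) x := by
    have e := hns.curl_timeDerivWithin_eq isOpen_Iio.uniqueDiffOn htS x
    rw [e, Pi.zero_apply, curl_zero, add_zero]
  -- (iii) the spatial transport term: `D‖ω‖²·v = 2⟪ω, Dω v⟫`
  have h3 : fderiv ℝ (fun y => ‖curl (v t) y‖ ^ 2) x (v t x) =
      2 * ⟪curl (v t) x, fderiv ℝ (curl (v t)) x (v t x)⟫ := by
    rw [hωd.hasFDerivAt.norm_sq.fderiv]
    simp
  -- (iv) the Laplacian: `Δ‖ω‖² = 2⟪Δω, ω⟫ + 2|Dω|²_F`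
  have h4 : (Δ fun y => ‖curl (v t) y‖ ^ 2) x =
      2 * ⟪curl (v t) x, (Δ (curl (v t))) x⟫ + 2 * frobeniusNormSq (fderiv ℝ (curl (v t)) x) := by
    have hfun : (fun y => ‖curl (v t) y‖ ^ 2) = fun y => ⟪curl (v t) y, curl (v t) y⟫ := by
      funext y
      exact (real_inner_self_eq_norm_sq _).symm
    rw [hfun, laplacian_inner_self_eq hω2 x, real_inner_comm]
  -- (v) algebra
  rw [h1, h2, h3, h4, convect_apply, convect_apply, inner_add_right, inner_sub_right,
    inner_smul_right]
  ring
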